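import Literature.MathematicalPhysics.QuantumFieldTheory.Balaban1983to89.Beta.SecondOrderResponse

/-!
# `BalabanUV.Beta.GAN24.BiStencilZeroMode` — binder row G-an2-4 / (CONV-C), W-slot (pre-trigger; idle-seat one-shot kernel lemma
# «T2-ZERO-MODE-KERNEL*», leaf-02 gen 15): THE ZERO-MODE (TOTAL) CHARGE OF A BLOCK-COVARIANT BI-STENCIL FAMILY AND THE CELL
# DECOMPOSITION OF LATTICE SUMS

NOT IN PRINT; OUR BOOKKEEPING (G-an2-4 formalisation swarm, idle leaf seat `b2b-balaban-gan24-formalise-leaf-02`, gen 15; the object of test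
(t1) of leaf-18 gen 15's note «T₂ ZERO MODE» ∕ `T2-ZERO-MODE.md` §3; module name PROVISIONAL — the row owner gan24-p1 ∕ the (P4) author an2 may
rename or re-home it).  HONEST FRAMING (cell contract, verbatim): «discharging `BetaPertH` makes Bałaban's UV stability UNCONDITIONAL — a real
constructive-QFT result; it is NOT the continuum limit and NOT the Clay problem.»  HONEST DEPENDENCY (verbatim): «continuum YM on T⁴ ⇐ BetaPertH
∧ nine spine estimates (0/9 proved); BetaPertH ⇐ (D1) ∧ (D4) ∧ CAP+tail; G-an2-4 gates asym, D1 and NE2/3/4.»  [folklore] lattice-sum algebra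
over an2's typed objects (`ExpKernelCalculus.MKer`∕`shiftK`, `OneStepResolventKernel.Fib`, `AffineAveraging.box`∕`toSite`,
`KKTFluctuationEnergy.tsum_blocks`, `InterLevelTransport.sublattice_injective` — BY NAME); cites nothing, mints no `def … : Prop`, instantiates
no wall binder, asserts NO shape of Bałaban's tables; «T2Shape» ∕ «T2SupRate» stay LOCATED ∕ OPEN; discharges NOTHING of (hW, hWall); NOT
«W-slot closed», NEVER «G-an2-4 closed»; NOT `BetaPertH`, NOT continuum, NOT Clay.

## What (generic `d`, period `N ≥ 1`)

* `Tab d` — the type of bi-stencil families `T κ u κ′ u′ : MKer (d+1) (Fib d)` (an2's `LocStencil₂` tables, `BalabanStepW2.T2Of j`, and — on the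
  coarse lattice — second-order vertex families `W μ y ν y′`).
* §1 `tsum_eq_sum_box_tsum` (`Σ'_u φ u = Σ_{r ∈ box} Σ'_t φ (N•t + r)`), `tsum_mul_periodic` (a weight against an `N`-periodic function sees
  only the CELL sums of the weight: `Σ'_u w u · ψ u = Σ_{r ∈ box} ψ r · Σ'_t w (N•t + r)`).
* §2 **`zmode N T κ κ′ a b := Σ_{r ∈ box (d+1) N} Σ'_{u′} Σ'_x Σ'_z T κ r κ′ u′ x z a b`** — the zero-momentum (total) charge per period cell
  (first bond over one cell, second bond and both kernel arguments over the lattice; no volume normalisation); `zmode_one` (period 1: the plain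
  triple sum at first bond `0`); `inner_periodic`: for a JOINTLY `N`-COVARIANT family (`T κ (u+N•t) κ′ (u′+N•t) = shiftK (−N•t) (T κ u κ′ u′)`,
  the hypothesis shape of an2's `SecondOrderResponse.vertex2OfK_translate`) the inner triple sum is `N`-periodic in the first bond.
Consumed by `GAN24/LinT2ZeroMode` (the charge of `mmRead N (K ∘ vertex2OfK K N T ∘ K)` in terms of `zmode N T`).
-/

noncomputable section

open Finset
open scoped BigOperators
open Literature.MathematicalPhysics.QuantumFieldTheory
open Literature.MathematicalPhysics.QuantumFieldTheory.Balaban1983to89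
open Literature.MathematicalPhysics.QuantumFieldTheory.Balaban1983to89.Beta
open ExpKernelCalculus (MKer shiftK)
open OneStepResolventKernel (Fib)
open AffineAveraging (box toSite)
open KKTFluctuationEnergy (tsum_blocks)
open InterLevelTransport (sublattice_injective)

namespace Summit.QuantumFields.BalabanUV.Beta.GAN24.BiStencilZeroMode

variable {d : ℕ}

/-- [folklore] The type of BI-STENCIL FAMILIES `T κ u κ′ u′ : MKer (d+1) (Fib d)` (a matrix kernel per ordered pair of fine bonds; the type of
an2's `LocStencil₂` tables, of `BalabanStepW2.T2Of j`, and — read on the coarse lattice — of second-order vertex families `W μ y ν y′`). -/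
abbrev Tab (d : ℕ) : Type :=
  Fin (d + 1) → (Fin (d + 1) → ℤ) → Fin (d + 1) → (Fin (d + 1) → ℤ) → MKer (d + 1) (Fib d)

/-! ## §1 Cell decomposition of lattice sums -/

/-- [folklore] **CELL DECOMPOSITION** of an absolutely convergent lattice sum: `Σ'_u φ u = Σ_{r ∈ box} Σ'_t φ (N•t + r)` (the block
regrouping `KKTFluctuationEnergy.tsum_blocks` with the finite offset sum taken outside). -/
theorem tsum_eq_sum_box_tsum {N : ℕ} [NeZero N] {φ : (Fin (d + 1) → ℤ) → ℝ} (hφ : Summable φ) :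
    ∑' u, φ u = ∑ r ∈ box (d + 1) N, ∑' t : Fin (d + 1) → ℤ, φ ((N : ℤ) • t + toSite r) := by
  rw [tsum_blocks (N := N) hφ]
  exact Summable.tsum_finsetSum fun r _ => hφ.comp_injective (sublattice_injective N (toSite r))

/-- [folklore] **A WEIGHT AGAINST AN `N`-PERIODIC FUNCTION**: `Σ'_u w u · ψ u = Σ_{r ∈ box} ψ r · Σ'_t w (N•t + r)` — only the CELL (coset)
sums of the weight are seen. -/
theorem tsum_mul_periodic {N : ℕ} [NeZero N] {w ψ : (Fin (d + 1) → ℤ) → ℝ} (hψ : ∀ u t, ψ (u + (N : ℤ) • t) = ψ u)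
    (hs : Summable fun u => w u * ψ u) :
    ∑' u, w u * ψ u = ∑ r ∈ box (d + 1) N, ψ (toSite r) * ∑' t : Fin (d + 1) → ℤ, w ((N : ℤ) • t + toSite r) := by
  rw [tsum_eq_sum_box_tsum (N := N) hs]
  refine Finset.sum_congr rfl fun r _ => ?_
  have e : ∀ t : Fin (d + 1) → ℤ, ψ ((N : ℤ) • t + toSite r) = ψ (toSite r) := fun t => by
    rw [add_comm]; exact hψ _ _
  simp_rw [e]
  rw [tsum_mul_right, mul_comm]

/-! ## §2 The zero-mode charge and joint block covariance -/

/-- [folklore] **THE ZERO-MODE CHARGE** of a bi-stencil family at period `N`: the first bond position runs over ONE CELL `box (d+1) N` of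
`ℤ^{d+1} ∕ N•ℤ^{d+1}`, the second bond position and the two kernel arguments over the whole lattice; per direction pair and fibre pair.
(For a jointly `N`-covariant family — `T κ (u+N•t) κ′ (u′+N•t) = shiftK (−N•t) (T κ u κ′ u′)`, the hypothesis shape of an2's
`SecondOrderResponse.vertex2OfK_translate` — this is the total charge per period cell; no normalisation by the cell volume.)  A definition asserting
nothing. -/
def zmode (N : ℕ) (T : Tab d) (κ κ' : Fin (d + 1)) (a b : Fib d) : ℝ :=
  ∑ r ∈ box (d + 1) N, ∑' u', ∑' x, ∑' z, T κ (toSite r) κ' u' x z a b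

/-- [folklore] The unit box is the origin. -/
theorem box_one (D : ℕ) : box D 1 = {fun _ => 0} := by
  ext b
  simp only [AffineAveraging.box, Fintype.mem_piFinset, Finset.mem_range, Nat.lt_one_iff, Finset.mem_singleton, funext_iff]

/-- [folklore] At period `1` the zero-mode charge is the plain triple lattice sum at first bond position `0`. -/
theorem zmode_one (T : Tab d) (κ κ' : Fin (d + 1)) (a b : Fib d) :
    zmode 1 T κ κ' a b = ∑' u', ∑' x, ∑' z, T κ 0 κ' u' x z a b := by
  have h0 : toSite (d := d + 1) (fun _ => 0) = 0 := by
    funext i; simp [toSite]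
  rw [zmode, box_one, Finset.sum_singleton, h0]

/-- [folklore] For a jointly covariant family the inner triple sum `u ↦ Σ'_{u′} Σ'_x Σ'_z T κ u κ′ u′ x z a b` is `N`-PERIODIC in the first
bond position (re-index the three lattice sums; no summability needed). -/
theorem inner_periodic {N : ℕ} {T : Tab d}
    (hT : ∀ κ u κ' u' t, T κ (u + (N : ℤ) • t) κ' (u' + (N : ℤ) • t) = shiftK (-((N : ℤ) • t)) (T κ u κ' u')) (κ κ' : Fin (d + 1)) (a b : Fib d)
    (u t : Fin (d + 1) → ℤ) :
    (∑' u', ∑' x, ∑' z, T κ (u + (N : ℤ) • t) κ' u' x z a b) = ∑' u', ∑' x, ∑' z, T κ u κ' u' x z a b := by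
  have step : ∀ G : (Fin (d + 1) → ℤ) → ℝ, ∑' v, G v = ∑' v, G (v + (N : ℤ) • t) := fun G =>
    ((Equiv.addRight ((N : ℤ) • t)).tsum_eq G).symm
  rw [step fun u' => ∑' x, ∑' z, T κ (u + (N : ℤ) • t) κ' u' x z a b]
  refine tsum_congr fun u' => ?_
  rw [step fun x => ∑' z, T κ (u + (N : ℤ) • t) κ' (u' + (N : ℤ) • t) x z a b]
  refine tsum_congr fun x => ?_
  rw [step fun z => T κ (u + (N : ℤ) • t) κ' (u' + (N : ℤ) • t) (x + (N : ℤ) • t) z a b]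
  refine tsum_congr fun z => ?_
  rw [hT]
  simp only [shiftK, add_neg_cancel_right]

end Summit.QuantumFields.BalabanUV.Beta.GAN24.BiStencilZeroMode
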